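import Summits.ResolutionOfSingularities.ResolutionOfSingularities.Theorems.PurelyInseparableDim4JointWaitingCover
import Summits.ResolutionOfSingularities.ResolutionOfSingularities.Theorems.PurelyInseparableDim4JointForestKidsModel
import HarnessLib

/-!
# Purely inseparable four-folds: the STEP of the joint forest at a root-type host WITH WAITING MEMBERS and the THREE-WAY
# COVER over the host — children / waiting kids / leaves (brick S3 (c) «joint point∘coordinate chains», part 37d = v3-lite
# step, corrected cover; cell `res-dim4-pi`)

[OURS · counted 0] (D-0157 DOOR 2; desk WORD #66 (4)(c), #74 (g), #99 (d); frame `PIDim4.TerminationImpliesOrderReduction`,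
S3 (c) v3-lite, memo `S3c-V3-DESIGN.md` Addenda 2–4; host item stmt-ResolutionOfSingularities-16155, helper). Nothing here
proves resolution of singularities in dimension ≥ 4 / characteristic `p` — NOT here, not anywhere in this programme.

Part 37's `joint_forest_step_waiting` inherits part 19's TWO-WAY cover hypothesis «every normalised equimultiple pair over the
host agrees with a plan entry or is a leaf». That is the wrong shape as soon as a waiting member is present: the points of the
waiting kid `T_B(j, c, T)` over the host (its intersection with the exceptional divisor, `{y_j = 0, y_i = c_i (i ∈ T)}` in the
`x_j`-chart — e.g. the curve `b₁ = 0, b₃ = 1` of the toy's `x₂`-chart, part 32a `cases_pair_one_F_toy`) are equimultiple pairs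
that are NEITHER children NOR finitely many leaves. THIS FILE restates the step with the THREE-WAY cover hypothesis
`hP5` «… agrees with a plan entry of its chart on `S″`, OR with a waiting entry of its chart on `T`, OR is a leaf» and proves:

* **`joint_forest_step_waiting_cover`** — children (part 37c) and waiting kids (part 35) with their coordinate-member data
  and the projection of each waiting kid; children pairwise disjoint, child ∩ waiting kid = ∅, waiting kids pairwise disjoint
  (as in part 37); THREE-WAY COVER over the host: a closed order-`p` point over the host lies on a child, on a waiting kid
  (typ-2's `mem_image_CΛ_chart_of_agree` with `S″ := T` — no `S ⊆ S″` needed), or carries a leaf chart with `(j′, b′) ∈ L`;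
  cover OFF the host into the waiting kids (part 36); the closed order-`p` points over the host off all children AND all
  waiting kids are finitely many (they inject into `L`).

AI-produced formalisation, weaker than expert review. bears_on: LADDER-RESOLUTION:D157-DOOR2 (res-dim4-pi · S3 (c) joint v3-lite).
-/

set_option linter.dupNamespace false -- D-0017: single-problem summit path `Summit.<S>.<S>.…` by design

noncomputable section

open MvPolynomial Finset CategoryTheory AlgebraicGeometry Opposite TopologicalSpace
open AlgebraicGeometry.Scheme.IdealSheafData (ofIdealTop vanishingIdeal)

namespace Summit.ResolutionOfSingularities.ResolutionOfSingularities.Theorems.PIDim4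

open Literature.AlgebraicGeometry.Resolution
open Literature.AlgebraicGeometry.Resolution.Hauser2010
open Literature.AlgebraicGeometry.Resolution.AffinePointBlowup (P A γ coord Wtop ξ)

namespace Equimultiple

section WaitingStep

variable {K : Type} [Field K] {p : ℕ} [hp : Fact p.Prime] [CharP K p] [DecidableEq K]
variable {Z Y W Bl : Scheme.{0}} (φ : Y ⟶ Z) [IsOpenImmersion φ] (ψ : Y ⟶ P 4 K) [IsOpenImmersion ψ]
  {π : W ⟶ Z} {B : Bl ⟶ P 4 K} {S : Finset (Fin 4)}
  (ε : (π ⁻¹ᵁ φ.opensRange : Scheme.{0}) ≅ (B ⁻¹ᵁ ψ.opensRange : Scheme.{0}))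

/-- **THE STEP OF THE JOINT FOREST AT A ROOT-TYPE HOST WITH WAITING MEMBERS, THREE-WAY COVER.** See the module docstring.
[cite: BierstoneGrigorievMilmanWlodarczyk2011, Def. 3.1.3; §4 Step 2b] [cite: Hauser2010, §§F–G]
[cite: GortzWedhorn2020, Prop. 13.91] -/
theorem joint_forest_step_waiting_cover [IsLocallyNoetherian Z] [IsAlgClosed K] (Zc : Z.IdealSheafData)
    (hπ : IsBlowup π Zc) (hB : IsBlowup B (AffineCoordBlowup.𝓘Λ 4 K (insert 0 (Fin.succ '' (S : Set (Fin 4))))))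
    (hsq : ε.hom ≫ (B ∣_ ψ.opensRange) = (π ∣_ φ.opensRange) ≫ (φ.isoOpensRange.inv ≫ ψ.isoOpensRange.hom))
    (hC' : ((AffineCoordBlowup.𝓘Λ 4 K (insert 0 (Fin.succ '' (S : Set (Fin 4))))).comap ψ.opensRange.ι).comap
        (φ.isoOpensRange.inv ≫ ψ.isoOpensRange.hom) = Zc.comap φ.opensRange.ι)
    (M : MarkedIdeal Z) (hmult : M.mult = p) (hbd : M.boundary = []) (s : State K)
    (hK : ((controlledTransform B (AffineCoordBlowup.𝓘Λ 4 K (insert 0 (Fin.succ '' (S : Set (Fin 4)))))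
        (hypSheaf p s.F) p).comap (B ⁻¹ᵁ ψ.opensRange).ι).comap ε.hom =
      (controlledTransform π Zc M.ideal p).comap (π ⁻¹ᵁ φ.opensRange).ι) (hS : IsPermissibleCentre p S s.F)
    (hsee : (AffineCoordBlowup.CΛ 4 K (insert 0 (Fin.succ '' (S : Set (Fin 4)))) : Set (P 4 K)) ⊆ Set.range ψ)
    (hT : IsClosed (φ '' (ψ ⁻¹' (AffineCoordBlowup.CΛ 4 K (insert 0 (Fin.succ '' (S : Set (Fin 4)))) : Set (P 4 K)))))
    (hψ : ∀ x : P 4 K, x ∈ Set.range ψ) (hφ : IsClosed (Set.range φ))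
    (hsncZ : HasSNCWith M.boundary Zc)
    (Pl : Finset (Fin 4 × (Fin 4 → K) × Finset (Fin 4)))
    (hP1 : ∀ e ∈ Pl, e.1 ∈ S ∧ e.2.1 e.1 = 0 ∧ S ⊆ e.2.2 ∧ CentreBlowup.IsEquimultiplePoint p S e.1 e.2.1 s ∧
      IsPermissibleCentre p e.2.2 (CentreBlowup.step p S e.1 e.2.1 s).F)
    (hP2 : ∀ e ∈ Pl, ∀ e' ∈ Pl, e ≠ e' →
      (e.1 = e'.1 ∧ ∃ i ∈ e.2.2, i ∈ e'.2.2 ∧ e.2.1 i ≠ e'.2.1 i) ∨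
      (e.1 ≠ e'.1 ∧ ((e'.2.1 e.1 = 0 ∧ e.1 ∈ e'.2.2) ∨ (e.2.1 e'.1 = 0 ∧ e'.1 ∈ e.2.2))))
    (Wt : Finset (Fin 4 × (Fin 4 → K) × Finset (Fin 4)))
    (hW1 : ∀ wt ∈ Wt, wt.1 ∈ S ∧ (∀ i ∈ S, wt.2.1 i = 0) ∧ S.erase wt.1 ⊆ wt.2.2 ∧ wt.1 ∉ wt.2.2 ∧
      IsPermissibleCentre p wt.2.2 (CentreBlowup.step p S wt.1 wt.2.1 s).F)
    (hW2 : ∀ wt ∈ Wt, ∀ wt' ∈ Wt, wt ≠ wt' → wt.1 = wt'.1 → ∃ i ∈ wt.2.2, i ∈ wt'.2.2 ∧ wt.2.1 i ≠ wt'.2.1 i)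
    (hPW : ∀ e ∈ Pl, ∀ wt ∈ Wt, e.1 = wt.1 → ∃ i ∈ e.2.2, i ∈ wt.2.2 ∧ e.2.1 i ≠ wt.2.1 i)
    (L : Finset (Fin 4 × (Fin 4 → K)))
    (hP5 : ∀ (j' : Fin 4) (b' : Fin 4 → K), j' ∈ S → b' j' = 0 → (∀ k ∈ S, k < j' → b' k = 0) →
      CentreBlowup.IsEquimultiplePoint p S j' b' s →
      (∃ e ∈ Pl, e.1 = j' ∧ ∀ i ∈ e.2.2, b' i = e.2.1 i) ∨ (∃ wt ∈ Wt, wt.1 = j' ∧ ∀ i ∈ wt.2.2, b' i = wt.2.1 i) ∨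
        (j', b') ∈ L) :
    ∃ kid wkid : Fin 4 × (Fin 4 → K) × Finset (Fin 4) → Closeds W,
      (∀ e ∈ Pl,
        Scheme.IsRegular (vanishingIdeal (kid e)).subscheme ∧
        HasSNCWith (M.transform π Zc).boundary (vanishingIdeal (kid e)) ∧
        (∃ (Y'' : Scheme.{0}) (φ'' : Y'' ⟶ W) (ψ'' : Y'' ⟶ P 4 K) (_ : IsOpenImmersion φ'') (_ : IsOpenImmersion ψ''),
          (M.transform π Zc).ideal.comap φ'' = (hypSheaf p (CentreBlowup.step p S e.1 e.2.1 s).F).comap ψ'' ∧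
          (vanishingIdeal (kid e)).comap φ'' =
            (AffineCoordBlowup.𝓘Λ 4 K (insert 0 (Fin.succ '' ((e.2.2 : Finset (Fin 4)) : Set (Fin 4))))).comap ψ'' ∧
          (kid e : Set W) ⊆ Set.range φ'' ∧
          (AffineCoordBlowup.CΛ 4 K (insert 0 (Fin.succ '' ((e.2.2 : Finset (Fin 4)) : Set (Fin 4)))) : Set (P 4 K)) ⊆
            Set.range ψ'' ∧
          ∃ (idx₂ : W.IdealSheafData → Fin 4) (cst₂ : W.IdealSheafData → K),
            (∀ D₂ ∈ (M.transform π Zc).boundary,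
              ((D₂.support : Set W) ∩ φ'' '' (ψ'' ⁻¹'
                (AffineCoordBlowup.CΛ 4 K (insert 0 (Fin.succ '' ((e.2.2 : Finset (Fin 4)) : Set (Fin 4)))) :
                  Set (P 4 K)))).Nonempty →
              D₂.comap φ'' = (ofIdealTop (Ideal.span {(γ 4 K).symm (X (idx₂ D₂).succ + C (cst₂ D₂))})).comap ψ'' ∧
                (idx₂ D₂ ∈ e.2.2 → cst₂ D₂ = 0)) ∧
            (∀ D₁ ∈ (M.transform π Zc).boundary, ∀ D₂ ∈ (M.transform π Zc).boundary,
              ((D₁.support : Set W) ∩ φ'' '' (ψ'' ⁻¹'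
                (AffineCoordBlowup.CΛ 4 K (insert 0 (Fin.succ '' ((e.2.2 : Finset (Fin 4)) : Set (Fin 4)))) :
                  Set (P 4 K)))).Nonempty →
              ((D₂.support : Set W) ∩ φ'' '' (ψ'' ⁻¹'
                (AffineCoordBlowup.CΛ 4 K (insert 0 (Fin.succ '' ((e.2.2 : Finset (Fin 4)) : Set (Fin 4)))) :
                  Set (P 4 K)))).Nonempty →
              idx₂ D₁ = idx₂ D₂ → D₁ = D₂)) ∧
        (kid e : Set W) ⊆ π ⁻¹' (φ '' (ψ ⁻¹'
          (AffineCoordBlowup.CΛ 4 K (insert 0 (Fin.succ '' (S : Set (Fin 4)))) : Set (P 4 K)))) ∧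
        (kid e : Set W).Nonempty) ∧
      (∀ wt ∈ Wt,
        Scheme.IsRegular (vanishingIdeal (wkid wt)).subscheme ∧
        HasSNCWith (M.transform π Zc).boundary (vanishingIdeal (wkid wt)) ∧
        (∃ (Y'' : Scheme.{0}) (φ'' : Y'' ⟶ W) (ψ'' : Y'' ⟶ P 4 K) (_ : IsOpenImmersion φ'') (_ : IsOpenImmersion ψ''),
          (M.transform π Zc).ideal.comap φ'' = (hypSheaf p (CentreBlowup.step p S wt.1 wt.2.1 s).F).comap ψ'' ∧
          (vanishingIdeal (wkid wt)).comap φ'' =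
            (AffineCoordBlowup.𝓘Λ 4 K (insert 0 (Fin.succ '' ((wt.2.2 : Finset (Fin 4)) : Set (Fin 4))))).comap ψ'' ∧
          (wkid wt : Set W) ⊆ Set.range φ'' ∧
          (AffineCoordBlowup.CΛ 4 K (insert 0 (Fin.succ '' ((wt.2.2 : Finset (Fin 4)) : Set (Fin 4)))) : Set (P 4 K)) ⊆
            Set.range ψ'' ∧
          ∃ (idx₂ : W.IdealSheafData → Fin 4) (cst₂ : W.IdealSheafData → K),
            (∀ D₂ ∈ (M.transform π Zc).boundary,
              ((D₂.support : Set W) ∩ φ'' '' (ψ'' ⁻¹'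
                (AffineCoordBlowup.CΛ 4 K (insert 0 (Fin.succ '' ((wt.2.2 : Finset (Fin 4)) : Set (Fin 4)))) :
                  Set (P 4 K)))).Nonempty →
              D₂.comap φ'' = (ofIdealTop (Ideal.span {(γ 4 K).symm (X (idx₂ D₂).succ + C (cst₂ D₂))})).comap ψ'' ∧
                (idx₂ D₂ ∈ wt.2.2 → cst₂ D₂ = 0)) ∧
            (∀ D₁ ∈ (M.transform π Zc).boundary, ∀ D₂ ∈ (M.transform π Zc).boundary,
              ((D₁.support : Set W) ∩ φ'' '' (ψ'' ⁻¹'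
                (AffineCoordBlowup.CΛ 4 K (insert 0 (Fin.succ '' ((wt.2.2 : Finset (Fin 4)) : Set (Fin 4)))) :
                  Set (P 4 K)))).Nonempty →
              ((D₂.support : Set W) ∩ φ'' '' (ψ'' ⁻¹'
                (AffineCoordBlowup.CΛ 4 K (insert 0 (Fin.succ '' ((wt.2.2 : Finset (Fin 4)) : Set (Fin 4)))) :
                  Set (P 4 K)))).Nonempty →
              idx₂ D₁ = idx₂ D₂ → D₁ = D₂)) ∧
        (∀ w ∈ (wkid wt : Set W),
          π w ∈ φ '' (ψ ⁻¹' {x : P 4 K | ∀ i ∈ wt.2.2, (X i.succ - C (wt.2.1 i) : A 4 K) ∈ x.asIdeal})) ∧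
        (wkid wt : Set W).Nonempty) ∧
      (∀ e ∈ Pl, ∀ e' ∈ Pl, e ≠ e' → Disjoint (kid e : Set W) (kid e' : Set W)) ∧
      (∀ e ∈ Pl, ∀ wt ∈ Wt, Disjoint (kid e : Set W) (wkid wt : Set W)) ∧
      (∀ wt ∈ Wt, ∀ wt' ∈ Wt, wt ≠ wt' → Disjoint (wkid wt : Set W) (wkid wt' : Set W)) ∧
      (∀ w : W, IsClosed ({w} : Set W) →
        π w ∈ φ '' (ψ ⁻¹' (AffineCoordBlowup.CΛ 4 K (insert 0 (Fin.succ '' (S : Set (Fin 4)))) : Set (P 4 K))) →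
        (p : ℕ∞) ≤ idealOrder (M.transform π Zc).ideal w →
        (∃ e ∈ Pl, w ∈ (kid e : Set W)) ∨ (∃ wt ∈ Wt, w ∈ (wkid wt : Set W)) ∨
        ∃ l ∈ L, l.1 ∈ S ∧ l.2 l.1 = 0 ∧ CentreBlowup.IsEquimultiplePoint p S l.1 l.2 s ∧
          ∃ (Y' : Scheme.{0}) (φ' : Y' ⟶ W) (ψ' : Y' ⟶ P 4 K) (_ : IsOpenImmersion φ') (_ : IsOpenImmersion ψ')
            (y' : Y'), φ' y' = w ∧ ψ' y' = ξ 4 K ∧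
            (M.transform π Zc).ideal.comap φ' = (hypSheaf p (CentreBlowup.step p S l.1 l.2 s).F).comap ψ') ∧
      (∀ w : W, IsClosed ({w} : Set W) → (p : ℕ∞) ≤ idealOrder (M.transform π Zc).ideal w →
        π w ∉ φ '' (ψ ⁻¹' (AffineCoordBlowup.CΛ 4 K (insert 0 (Fin.succ '' (S : Set (Fin 4)))) : Set (P 4 K))) →
        ∀ wt ∈ Wt, π w ∈ φ '' (ψ ⁻¹' {x : P 4 K | ∀ i ∈ wt.2.2, (X i.succ - C (wt.2.1 i) : A 4 K) ∈ x.asIdeal}) →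
          w ∈ (wkid wt : Set W)) ∧
      {w : W | IsClosed ({w} : Set W) ∧
        π w ∈ φ '' (ψ ⁻¹' (AffineCoordBlowup.CΛ 4 K (insert 0 (Fin.succ '' (S : Set (Fin 4)))) : Set (P 4 K))) ∧
        (p : ℕ∞) ≤ idealOrder (M.transform π Zc).ideal w ∧ (∀ e ∈ Pl, w ∉ (kid e : Set W)) ∧
        ∀ wt ∈ Wt, w ∉ (wkid wt : Set W)}.Finite := by
  classical
  -- the children, through the given `ε`, with their model descriptions
  obtain ⟨kid, hkid, hkdisj⟩ := joint_forest_kids_model φ ψ ε Zc hπ hB hsq hC' M hmult s hK hS hsee hT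
    hsncZ (fun _ => 0) (fun _ => 0) (fun D hD => by simp [hbd] at hD) (fun D hD => by simp [hbd] at hD) Pl hP1 hP2
  -- model images of points over the host
  have hmodel := fun (w : W) (hw : IsClosed ({w} : Set W)) hwx
      (hord : (p : ℕ∞) ≤ idealOrder (M.transform π Zc).ideal w) =>
    leaf_model_point_normalised φ ψ ε Zc hB hsq M hmult s hK hS.2 hw hwx hord
  -- the waiting kids
  have wkidEx := fun (wt : Fin 4 × (Fin 4 → K) × Finset (Fin 4)) (hwt : wt ∈ Wt) =>
    waiting_kid_package_of_iso φ ψ ε Zc hπ hB hsq hC' M hmult hbd s hK hS.2 hsee hT hψ hφ hsncZ (hW1 wt hwt).1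
      ((hW1 wt hwt).2.1 _ (hW1 wt hwt).1) (hW1 wt hwt).2.1 (hW1 wt hwt).2.2.1 (hW1 wt hwt).2.2.2.1
  let wkid : Fin 4 × (Fin 4 → K) × Finset (Fin 4) → Closeds W := fun wt =>
    if hwt : wt ∈ Wt then (wkidEx wt hwt).choose else ⊥
  have hwkid : ∀ wt (hwt : wt ∈ Wt), wkid wt = (wkidEx wt hwt).choose := fun wt hwt => dif_pos hwt
  -- membership criteria: a model point agreeing with an entry / a waiting entry lies on its child / waiting kid
  have hin_kid : ∀ e (he : e ∈ Pl) (w : W) (hwV : w ∈ π ⁻¹ᵁ φ.opensRange) (x : P 4 K) (a' : K) (b' : Fin 4 → K)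
      (hj' : e.1 ∈ S),
      AffineCoordBlowup.chartImm hB (ChartDictionary.succ_mem_centreVars hj') x = (B ⁻¹ᵁ ψ.opensRange).ι (ε.hom ⟨w, hwV⟩) →
      x.asIdeal = MvPolynomial.vanishingIdeal K {(Fin.cons a' b' : Fin (4 + 1) → K)} →
      a' ^ p + MvPolynomial.eval b' (CentreBlowup.chartTransform p S e.1 s.F) = 0 →
      (∀ i ∈ e.2.2, b' i = e.2.1 i) → w ∈ (kid e : Set W) := by
    intro e he w hwV x a' b' hj' hxw hx hab hagree
    obtain ⟨-, -, -, -, -, Θ, hs, hc, hmem⟩ := hkid e he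
    rw [hmem w hwV, ← hxw]
    exact ChartDictionary.mem_image_CΛ_chart_of_agree (hP1 _ he).1 hs hB hp.out.ne_zero s hS.2
      (hP1 _ he).2.2.2.2.2 hc hx hab hagree
  have hin_wkid : ∀ wt (hwt : wt ∈ Wt) (w : W) (hwV : w ∈ π ⁻¹ᵁ φ.opensRange) (x : P 4 K) (a' : K) (b' : Fin 4 → K)
      (hj' : wt.1 ∈ S),
      AffineCoordBlowup.chartImm hB (ChartDictionary.succ_mem_centreVars hj') x = (B ⁻¹ᵁ ψ.opensRange).ι (ε.hom ⟨w, hwV⟩) →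
      x.asIdeal = MvPolynomial.vanishingIdeal K {(Fin.cons a' b' : Fin (4 + 1) → K)} →
      a' ^ p + MvPolynomial.eval b' (CentreBlowup.chartTransform p S wt.1 s.F) = 0 →
      (∀ i ∈ wt.2.2, b' i = wt.2.1 i) → w ∈ (wkid wt : Set W) := by
    intro wt hwt w hwV x a' b' hj' hxw hx hab hagree
    rw [hwkid wt hwt]
    obtain ⟨Θ, hs, hc, hmem, -⟩ := (wkidEx wt hwt).choose_spec
    rw [hmem w hwV, ← hxw]
    exact ChartDictionary.mem_image_CΛ_chart_of_agree (hW1 _ hwt).1 hs hB hp.out.ne_zero s hS.2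
      (hW1 _ hwt).2.2.2.2.2 hc hx hab hagree
  refine ⟨kid, wkid, fun e he => ?_, fun wt hwt => ?_, hkdisj, fun e he wt hwt => ?_, fun wt hwt wt' hwt' hne => ?_,
    fun w hw hwx hord => ?_, fun w hw hord hoff wt hwt hwT => ?_, ?_⟩
  · -- data of a child
    obtain ⟨hreg, hsnc, hzig, hover, hne, -⟩ := hkid e he
    exact ⟨hreg, hsnc, hzig, hover, hne⟩
  · -- data of a waiting kid
    rw [hwkid wt hwt]
    obtain ⟨Θ, -, -, -, hproj, hne, hreg, hsnc, hzig⟩ := (wkidEx wt hwt).choose_spec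
    exact ⟨hreg, hsnc, hzig, hproj, hne⟩
  · -- a child and a waiting kid are disjoint
    rw [hwkid wt hwt]
    obtain ⟨-, -, -, hover, -, Θ, hs, hc, hmem⟩ := hkid e he
    obtain ⟨Θ', hs', hc', hmem', -⟩ := (wkidEx wt hwt).choose_spec
    have hsR : ∀ k : Fin 4, (Θ : A 4 K →+* A 4 K) (X k.succ) = X k.succ + C (e.2.1 k) := fun k => hs k
    have hsR' : ∀ k : Fin 4, (Θ' : A 4 K →+* A 4 K) (X k.succ) = X k.succ + C (wt.2.1 k) := fun k => hs' k
    have hCR : ∀ r : K, (Θ : A 4 K →+* A 4 K) (C r) = C r := fun r => Θ.commutes r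
    have hCR' : ∀ r : K, (Θ' : A 4 K →+* A 4 K) (C r) = C r := fun r => Θ'.commutes r
    rw [Set.disjoint_left]
    intro w hw hw'
    have hwV : w ∈ π ⁻¹ᵁ φ.opensRange := by
      obtain ⟨y, -, hy⟩ := hover hw
      exact ⟨y, hy⟩
    have h1 := (hmem w hwV).mp hw
    have h2 := (hmem' w hwV).mp hw'
    by_cases hjj : e.1 = wt.1
    · -- same chart, separated on `S″ ∩ T`
      obtain ⟨i, hi, hi', hbi⟩ := hPW e he wt hwt hjj
      obtain ⟨j, b, S''⟩ := e
      obtain ⟨j', c, T⟩ := wt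
      simp only at hjj hi hi' hbi hsR hsR' h1 h2
      subst hjj
      exact Set.disjoint_left.mp (ChartDictionary.disjoint_image_CΛ_chart_of_ne (hP1 _ he).1 hCR hsR hCR' hsR' hB
        hi hi' hbi) h1 h2
    · -- different charts: the waiting kid is re-centred at `c` with `c_{j} = 0`, and `j ∈ T`
      have hjT : e.1 ∈ wt.2.2 := (hW1 wt hwt).2.2.1 (Finset.mem_erase.mpr ⟨hjj, (hP1 e he).1⟩)
      exact Set.disjoint_left.mp (ChartDictionary.disjoint_image_CΛ_chart_of_ne_chart (hP1 e he).1 (hW1 wt hwt).1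
        hjj hsR' ((hW1 wt hwt).2.1 _ (hP1 e he).1) hB hjT) h1 h2
  · -- two waiting kids are disjoint
    rw [hwkid wt hwt, hwkid wt' hwt']
    obtain ⟨Θ, hs, hc, hmem, hproj, -⟩ := (wkidEx wt hwt).choose_spec
    obtain ⟨Θ', hs', hc', hmem', -⟩ := (wkidEx wt' hwt').choose_spec
    have hsR : ∀ k : Fin 4, (Θ : A 4 K →+* A 4 K) (X k.succ) = X k.succ + C (wt.2.1 k) := fun k => hs k
    have hsR' : ∀ k : Fin 4, (Θ' : A 4 K →+* A 4 K) (X k.succ) = X k.succ + C (wt'.2.1 k) := fun k => hs' k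
    have hCR : ∀ r : K, (Θ : A 4 K →+* A 4 K) (C r) = C r := fun r => Θ.commutes r
    have hCR' : ∀ r : K, (Θ' : A 4 K →+* A 4 K) (C r) = C r := fun r => Θ'.commutes r
    rw [Set.disjoint_left]
    intro w hw hw'
    have hwV : w ∈ π ⁻¹ᵁ φ.opensRange := by
      obtain ⟨y, -, hy⟩ := hproj w hw
      exact ⟨y, hy⟩
    have h1 := (hmem w hwV).mp hw
    have h2 := (hmem' w hwV).mp hw'
    by_cases hjj : wt.1 = wt'.1
    · -- same chart, separated on `T ∩ T′`
      obtain ⟨i, hi, hi', hbi⟩ := hW2 wt hwt wt' hwt' hne hjj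
      obtain ⟨j, c, T⟩ := wt
      obtain ⟨j', c', T'⟩ := wt'
      simp only at hjj hi hi' hbi hsR hsR' h1 h2
      subst hjj
      exact Set.disjoint_left.mp (ChartDictionary.disjoint_image_CΛ_chart_of_ne (hW1 _ hwt).1 hCR hsR hCR' hsR' hB
        hi hi' hbi) h1 h2
    · -- different charts: automatic
      have hjT : wt.1 ∈ wt'.2.2 := (hW1 wt' hwt').2.2.1 (Finset.mem_erase.mpr ⟨hjj, (hW1 wt hwt).1⟩)
      exact Set.disjoint_left.mp (ChartDictionary.disjoint_image_CΛ_chart_of_ne_chart (hW1 wt hwt).1 (hW1 wt' hwt').1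
        hjj hsR' ((hW1 wt' hwt').2.1 _ (hW1 wt hwt).1) hB hjT) h1 h2
  · -- THREE-WAY COVER over the host: child, waiting kid, or leaf chart
    obtain ⟨hwV, j', hj', x, a', b', hxw, hx, hab, hbj', hnorm, heq⟩ := hmodel w hw hwx hord
    rcases hP5 j' b' hj' hbj' hnorm heq with ⟨e, he, hej, hagree⟩ | ⟨wt, hwt, hej, hagree⟩ | hl
    · subst hej
      exact Or.inl ⟨e, he, hin_kid e he w hwV x a' b' hj' hxw hx hab hagree⟩
    · subst hej
      exact Or.inr (Or.inl ⟨wt, hwt, hin_wkid wt hwt w hwV x a' b' hj' hxw hx hab hagree⟩)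
    · obtain ⟨Θ, -, -, -, hchart⟩ := leaf_chart φ ψ ε Zc hB M hmult s hK hS.2 hwV hj' hxw hx hab hbj'
      exact Or.inr (Or.inr ⟨(j', b'), hl, hj', hbj', heq, hchart⟩)
  · -- a closed order-`p` point off the host over the waiting coordinates lies on the waiting kid
    rw [hwkid wt hwt]
    obtain ⟨Θ, hs, hc, hmem, -⟩ := (wkidEx wt hwt).choose_spec
    have hwV : w ∈ π ⁻¹ᵁ φ.opensRange := by
      obtain ⟨y, -, hy⟩ := hwT
      exact ⟨y, hy⟩
    rw [hmem w hwV]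
    exact ιε_mem_image_CΛ_of_off_host φ ψ ε Zc hB hsq M hmult s hK hS.2 (hW1 wt hwt).1 (hW1 wt hwt).2.1
      (hW1 wt hwt).2.2.1 (hW1 wt hwt).2.2.2.1 hs (hW1 wt hwt).2.2.2.2.2 hc hw hwV hord hoff hwT
  · -- the leaf points are finitely many: they inject into `L`
    have cover : ∀ w : W, IsClosed ({w} : Set W) →
        π w ∈ φ '' (ψ ⁻¹' (AffineCoordBlowup.CΛ 4 K (insert 0 (Fin.succ '' (S : Set (Fin 4)))) : Set (P 4 K))) →
        (p : ℕ∞) ≤ idealOrder (M.transform π Zc).ideal w → (∀ e ∈ Pl, w ∉ (kid e : Set W)) →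
        (∀ wt ∈ Wt, w ∉ (wkid wt : Set W)) →
        ∃ l : Fin 4 × (Fin 4 → K), l ∈ L ∧ ∃ (hwV : w ∈ π ⁻¹ᵁ φ.opensRange) (hj : l.1 ∈ S) (x : P 4 K) (a : K),
          AffineCoordBlowup.chartImm hB (ChartDictionary.succ_mem_centreVars hj) x =
              (B ⁻¹ᵁ ψ.opensRange).ι (ε.hom ⟨w, hwV⟩) ∧
            x.asIdeal = MvPolynomial.vanishingIdeal K {(Fin.cons a l.2 : Fin (4 + 1) → K)} ∧
              a ^ p + MvPolynomial.eval l.2 (CentreBlowup.chartTransform p S l.1 s.F) = 0 := by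
      intro w hw hwx hord hout houtw
      obtain ⟨hwV, j', hj', x, a', b', hxw, hx, hab, hbj', hnorm, heq⟩ := hmodel w hw hwx hord
      rcases hP5 j' b' hj' hbj' hnorm heq with ⟨e, he, hej, hagree⟩ | ⟨wt, hwt, hej, hagree⟩ | hl
      · subst hej
        exact absurd (hin_kid e he w hwV x a' b' hj' hxw hx hab hagree) (hout e he)
      · subst hej
        exact absurd (hin_wkid wt hwt w hwV x a' b' hj' hxw hx hab hagree) (houtw wt hwt)
      · exact ⟨(j', b'), hl, hwV, hj', x, a', hxw, hx, hab⟩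
    let g : W → Fin 4 × (Fin 4 → K) := fun w =>
      if hc : IsClosed ({w} : Set W) ∧
          π w ∈ φ '' (ψ ⁻¹' (AffineCoordBlowup.CΛ 4 K (insert 0 (Fin.succ '' (S : Set (Fin 4)))) : Set (P 4 K))) ∧
          (p : ℕ∞) ≤ idealOrder (M.transform π Zc).ideal w ∧ (∀ e ∈ Pl, w ∉ (kid e : Set W)) ∧
          ∀ wt ∈ Wt, w ∉ (wkid wt : Set W)
      then (cover w hc.1 hc.2.1 hc.2.2.1 hc.2.2.2.1 hc.2.2.2.2).choose else ((0 : Fin 4), (0 : Fin 4 → K))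
    refine Set.Finite.of_finite_image (f := g) ((Finset.finite_toSet L).subset ?_) ?_
    · rintro _ ⟨w, hw, rfl⟩
      have hg : g w = (cover w hw.1 hw.2.1 hw.2.2.1 hw.2.2.2.1 hw.2.2.2.2).choose := dif_pos hw
      rw [hg]
      exact (cover w hw.1 hw.2.1 hw.2.2.1 hw.2.2.2.1 hw.2.2.2.2).choose_spec.1
    · intro w hw w' hw' hgg
      have hg : g w = (cover w hw.1 hw.2.1 hw.2.2.1 hw.2.2.2.1 hw.2.2.2.2).choose := dif_pos hw
      have hg' : g w' = (cover w' hw'.1 hw'.2.1 hw'.2.2.1 hw'.2.2.2.1 hw'.2.2.2.2).choose := dif_pos hw'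
      have key : ∀ l l' : Fin 4 × (Fin 4 → K), l = l' →
          (∃ (hwV : w ∈ π ⁻¹ᵁ φ.opensRange) (hj : l.1 ∈ S) (x : P 4 K) (a : K),
            AffineCoordBlowup.chartImm hB (ChartDictionary.succ_mem_centreVars hj) x =
                (B ⁻¹ᵁ ψ.opensRange).ι (ε.hom ⟨w, hwV⟩) ∧
              x.asIdeal = MvPolynomial.vanishingIdeal K {(Fin.cons a l.2 : Fin (4 + 1) → K)} ∧
                a ^ p + MvPolynomial.eval l.2 (CentreBlowup.chartTransform p S l.1 s.F) = 0) →
          (∃ (hwV : w' ∈ π ⁻¹ᵁ φ.opensRange) (hj : l'.1 ∈ S) (x : P 4 K) (a : K),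
            AffineCoordBlowup.chartImm hB (ChartDictionary.succ_mem_centreVars hj) x =
                (B ⁻¹ᵁ ψ.opensRange).ι (ε.hom ⟨w', hwV⟩) ∧
              x.asIdeal = MvPolynomial.vanishingIdeal K {(Fin.cons a l'.2 : Fin (4 + 1) → K)} ∧
                a ^ p + MvPolynomial.eval l'.2 (CentreBlowup.chartTransform p S l'.1 s.F) = 0) →
          w = w' := by
        rintro l _ rfl ⟨hwV, hj, x, a, hxw, hx, hab⟩ ⟨hwV', hj', x', a', hxw', hx', hab'⟩
        have haa : a = a' := by
          apply frobenius_inj K p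
          rw [frobenius_def, frobenius_def, eq_neg_of_add_eq_zero_left hab, eq_neg_of_add_eq_zero_left hab']
        have hxx : x = x' := by
          apply PrimeSpectrum.ext
          rw [hx, hx', haa]
        subst hxx
        have h1 : (B ⁻¹ᵁ ψ.opensRange).ι (ε.hom ⟨w, hwV⟩) = (B ⁻¹ᵁ ψ.opensRange).ι (ε.hom ⟨w', hwV'⟩) :=
          hxw.symm.trans hxw'
        have h2 := ε.hom.isOpenEmbedding.injective ((B ⁻¹ᵁ ψ.opensRange).ι.isOpenEmbedding.injective h1)
        have h3 := Subtype.ext_iff.mp h2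
        exact h3
      exact key _ _ (hg.symm.trans (hgg.trans hg')) (cover w hw.1 hw.2.1 hw.2.2.1 hw.2.2.2.1 hw.2.2.2.2).choose_spec.2
        (cover w' hw'.1 hw'.2.1 hw'.2.2.1 hw'.2.2.2.1 hw'.2.2.2.2).choose_spec.2

end WaitingStep

end Equimultiple

end Summit.ResolutionOfSingularities.ResolutionOfSingularities.Theorems.PIDim4

end
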